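import Literature.RepresentationTheory.FiniteGroups.SymmetricGroupCosetSpan
import Literature.NumberTheory.DiophantineGeometry.SymmetricGroupRepsIrreducibleProofs
import Literature.NumberTheory.DiophantineGeometry.SymmetricGroupRepsFinrankSpechtProofs
import HarnessLib

/-!
# Fourier transforms of small left-invariant spaces of functions on `𝔖ₙ` vanish at large irreducibles

Ellis–Friedgut–Pilpel, *Intersecting families of permutations*, J. AMS 24 (2011), §2.2 (p. 6):
the Fourier transform `f̂(ρ) = Σ_s f(s) ρ(s)` at an irreducible representation `ρ` intertwines
left translation, `(L_τ f)^(ρ) = ρ(τ) f̂(ρ)` ("the Fourier transform … turns left translation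
into left multiplication").  Consequently (Schur / irreducibility, James LNM 682 Thm. 4.12 for the
Specht modules `S^μ`): if `W` is a left-translation-invariant space of functions on `𝔖ₙ` and
`dim W < dim S^μ = f^μ`, then `f̂([μ]) = 0` for every `f ∈ W` — the image `{f̂([μ]) v}` of `W` in
`S^μ` is a subrepresentation of dimension `≤ dim W < f^μ`, hence zero.  This is the dimension
half of the "small invariant subspaces have low Fourier degree" principle used for the
perfect-matching scheme in the cell pnp-psdrank's rung route `EquivariantThetaLift` (crux
`InvariantSubspaceLowDegree`).

* `leftTranslate τ f = f(τ⁻¹ ·)`, `fourierSpecht_leftTranslate`;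
* `fourierSpecht_eq_zero_of_finrank_lt` — the vanishing theorem.

## References

* D. Ellis, E. Friedgut, H. Pilpel, *Intersecting families of permutations*, J. Amer. Math. Soc.
  24 (2011) 649–682, §2.2 (p. 6). [EllisFriedgutPilpel2011]
* G. D. James, *The Representation Theory of the Symmetric Groups*, LNM 682, Thm. 4.12
  (irreducibility of `S^μ`), Thm. 8.4 (`dim S^μ = f^μ`). [JamesLNM682]
-/

noncomputable section

open scoped BigOperators

namespace Literature.RepresentationTheory.FiniteGroups

open Literature.NumberTheory.DiophantineGeometry

variable {n : ℕ}

/-- Left translation `(L_τ f)(σ) = f(τ⁻¹ σ)`. [cite: EllisFriedgutPilpel2011, §2.2 (p. 6)] -/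
def leftTranslate (τ : Equiv.Perm (Fin n)) (f : Equiv.Perm (Fin n) → ℂ) : Equiv.Perm (Fin n) → ℂ :=
  fun σ => f (τ⁻¹ * σ)

/-- **`(L_τ f)^([μ]) = ρ_μ(τ) ∘ f̂([μ])`.** [cite: EllisFriedgutPilpel2011, §2.2 (p. 6)] -/
theorem fourierSpecht_leftTranslate (τ : Equiv.Perm (Fin n)) (f : Equiv.Perm (Fin n) → ℂ)
    (μ : Nat.Partition n) :
    fourierSpecht (leftTranslate τ f) μ = spechtRep ℂ μ τ * fourierSpecht f μ := by
  unfold fourierSpecht leftTranslate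
  rw [Finset.mul_sum]
  -- reindex `σ = τ σ'`
  rw [← (Fintype.sum_bijective (fun σ => τ * σ) (Group.mulLeft_bijective τ) _ _ fun σ => rfl)]
  refine Finset.sum_congr rfl fun σ _ => ?_
  rw [inv_mul_cancel_left, map_mul, mul_smul_comm]

/-- A space of functions on `𝔖ₙ` is left-invariant. [cite: EllisFriedgutPilpel2011, §3.2.3 (p. 13, "two-sided ideal")] -/
def IsLeftInvariant (W : Submodule ℂ (Equiv.Perm (Fin n) → ℂ)) : Prop :=
  ∀ τ : Equiv.Perm (Fin n), ∀ f ∈ W, leftTranslate τ f ∈ W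

/-- The Fourier transform at `[μ]` as a linear map. [cite: EllisFriedgutPilpel2011, §2.2 (p. 6)] -/
def fourierSpechtₗ (μ : Nat.Partition n) :
    (Equiv.Perm (Fin n) → ℂ) →ₗ[ℂ] Module.End ℂ (spechtIdeal ℂ μ) where
  toFun f := fourierSpecht f μ
  map_add' f g := fourierSpecht_add f g μ
  map_smul' c f := fourierSpecht_smul c f μ

/-- Unfolding. [cite: EllisFriedgutPilpel2011, §2.2 (p. 6)] -/
theorem fourierSpechtₗ_apply (μ : Nat.Partition n) (f : Equiv.Perm (Fin n) → ℂ) :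
    fourierSpechtₗ μ f = fourierSpecht f μ := rfl

/-- **Small left-invariant spaces have vanishing Fourier transform at large irreducibles**: if
`W` is left-invariant and `dim W < f^μ = dim S^μ`, then `f̂([μ]) = 0` for all `f ∈ W`.
[cite: EllisFriedgutPilpel2011, §2.2 (p. 6)] [cite: JamesLNM682, Thm. 4.12 and Thm. 8.4] -/
theorem fourierSpecht_eq_zero_of_finrank_lt (W : Submodule ℂ (Equiv.Perm (Fin n) → ℂ))
    (hW : IsLeftInvariant W) (μ : Nat.Partition n)
    (hdim : Module.finrank ℂ W < numStandardTableaux μ) :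
    ∀ f ∈ W, fourierSpecht f μ = 0 := by
  classical
  intro f₀ hf₀
  by_contra hne
  -- a vector not killed by `f̂₀([μ])`
  obtain ⟨v, hv⟩ : ∃ v : spechtIdeal ℂ μ, fourierSpecht f₀ μ v ≠ 0 := by
    by_contra h
    push Not at h
    exact hne (LinearMap.ext fun v => by rw [h v, LinearMap.zero_apply])
  -- the image `Y = {f̂([μ]) v : f ∈ W}` is a subrepresentation of `S^μ`
  let ev : Module.End ℂ (spechtIdeal ℂ μ) →ₗ[ℂ] spechtIdeal ℂ μ := LinearMap.applyₗ v
  let Y : Submodule ℂ (spechtIdeal ℂ μ) := (W.map (fourierSpechtₗ μ)).map ev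
  have hYmem : ∀ f ∈ W, fourierSpecht f μ v ∈ Y := fun f hf =>
    Submodule.mem_map_of_mem (Submodule.mem_map_of_mem hf)
  have hYinv : ∀ τ : Equiv.Perm (Fin n), ∀ y ∈ Y, spechtRep ℂ μ τ y ∈ Y := by
    intro τ y hy
    obtain ⟨T, hT, rfl⟩ := Submodule.mem_map.1 hy
    obtain ⟨f, hf, rfl⟩ := Submodule.mem_map.1 hT
    change spechtRep ℂ μ τ (fourierSpecht f μ v) ∈ Y
    have h := hYmem _ (hW τ f hf)
    rw [fourierSpecht_leftTranslate] at h
    exact h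
  let Yrep : Subrepresentation (spechtRep ℂ μ) := ⟨Y, fun τ y hy => hYinv τ y hy⟩
  -- irreducibility: `Y = ⊥` or `Y = ⊤`
  haveI : (spechtRep ℂ μ).IsIrreducible := isIrreducible_spechtRep_holds (k := ℂ) μ
  rcases IsSimpleOrder.eq_bot_or_eq_top Yrep with h | h
  · have hY : Y = ⊥ := congrArg Subrepresentation.toSubmodule h
    have : fourierSpecht f₀ μ v ∈ (⊥ : Submodule ℂ (spechtIdeal ℂ μ)) := hY ▸ hYmem f₀ hf₀
    exact hv ((Submodule.mem_bot ℂ).1 this)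
  · have hY : Y = ⊤ := congrArg Subrepresentation.toSubmodule h
    -- dimensions: `f^μ = dim S^μ = dim Y ≤ dim W < f^μ`
    have h1 : Module.finrank ℂ Y ≤ Module.finrank ℂ W :=
      (Submodule.finrank_map_le _ _).trans (Submodule.finrank_map_le _ _)
    have h2 : Module.finrank ℂ Y = numStandardTableaux μ := by
      rw [hY, finrank_top, finrank_spechtIdeal_holds (k := ℂ) μ]
    omega

end Literature.RepresentationTheory.FiniteGroups
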